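import Literature.Analysis.Calculus.ExpDifferentialAdSeries
import Summits.QuantumFields.YangMills.Theorems.UnitScaleTiltProp7SymAvgTwSymDefs
import Summits.QuantumFields.YangMills.Theorems.UnitScaleTiltProp7Growth142T3ChartELStat
import HarnessLib

/-!
# Route `UnitScaleTilt`, crux K1 child «MinimiserStabilityRegPr» (stmt-QuantumFields-19200), skeleton v10, stub `stub_existenceMinimalOrbit` (EX), route (α) — **THE VELOCITY
# LETTER AT THE CHART POINT: `d∕dt|₀ e^{A₁+tα}·U₀·(e^{A₁}U₀)^* = g(ad(−A₁))α` AND THE RE-BASING OF THE RELATIVE AVERAGE FROM `U₀` TO `U′ = e^{A₁}U₀`** (brick T1 of the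
# chart-side TRANSPORT of `hXtw‴`(iii), ★w2-19200 g4's LOCATE memo v1.2 §7 «(47)-CHART DERIVATIVE ∕ TRANSPORT», items (DEXP)∕(D47); junction ★★`Prop7TangentCriticalSplit.tangentCritical_su2_of_split`).

Cell `ym3-torus`, width seat `ym-ust-20520-w5` (gen 6; TwS-chart lineage).  THEOREMS ONLY (0 `def`, 0 `sorry`).  `--supports stmt-QuantumFields-19200 --as helper`, count-neutral.
YM₃ on T³ is a ladder rung (R3), not the Clay problem; nothing here claims the stub, the crux, d = 4 or the mass gap.

THE POINT.  The EX knit's chart is centred at the background `U₀` (configurations `e^{A}U₀`), but tangent-criticality is needed at the chart point `U′ = e^{A₁}U₀`, `A₁ ≠ 0`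
(print re-centres at `U_k`, [Balaban1985Variational] p.299, which presupposes criticality).  So the velocity of a chart curve `t ↦ e^{A₁ + tα}U₀` at `U′`, right-trivialised as in
✓`Prop7FibreELOfTangentCritical` ∕ ✓`Prop7Growth142T3ChartELStat.hasDerivAt_wilsonAction4_of_hasDerivAt_mulStar` (`ξ(b) = γ̇(b)·U′(b)^*`), is NOT `α` but the trivialised differential of the
exponential: `ξ(b) = Dexp_{A₁(b)}(α(b))·e^{−A₁(b)} = g(ad(−A₁(b)))(α(b))`, `g(z) = (1 − e^{−z})∕z` — [Balaban1985Averaging] (32)–(34), in the tree as ✓`Literature.Analysis.Calculus.ExpDifferential`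
(`hasFDerivAt_exp_dexp`, `dexp_apply`, `exp_ad_apply`, `exp_ad_mul_gSer_ad`, `isUnit_gSer`, `norm_gSer_sub_one_le`).  This file packages that letter for the route's carriers and
re-bases the relative `(M₂)ˣ`-average: near `A₁`, `e^{A}U₀ = e^{Ã(A)}U′` with `Ã(A)(b) = log(e^{A(b)}e^{−A₁(b)})`, `Ã(A₁) = 0`, `DÃ(A₁) = M := (α ↦ g(ad(−A₁(b)))α(b))_b`; hence the
derivative at `A₁` of `A ↦ D̄(e^{A}U₀)·D̄(U₀)⁻¹` is `(G′ ∘ M)·(D̄(U′)D̄(U₀)⁻¹)` where `G′` is the derivative at `0` of the relative average based at `U′` — the `hG` letter of the glue.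

WHAT IS PROVED (sorry-free, no definition; `g`, `ad` are ✓`ExpDifferential.gSer ℂ`, `ExpDifferential.ad ℂ`).
* §1 (any complete normed `ℂ`-algebra `𝔸`): `dexp_apply_mul_exp_neg` (`Dexp_X(h)·e^{−X} = g(ad(−X))h`), ★`hasDerivAt_exp_add_smul_mul` (`d∕dt (e^{X+tα}·P) = e^{X}·g(ad X)α·P` at `t = 0`, real `t`),
  ★★`hasDerivAt_exp_add_smul_mul_mul_star` (`Xᴴ = −X`, `P·Pᴴ = 1` ⟹ `d∕dt|₀ e^{X+tα}·P·(e^{X}P)ᴴ = g(ad(−X))α` — THE VELOCITY LETTER), ★★`hasDerivAt_exp_comp_mul_mul_star` (the same along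
  any exponent curve `c` with `c′(0) = α`), ★`isUnit_gSer_ad_neg`∕`norm_gSer_ad_neg_sub_one_le`
  (`‖X‖ ≤ ½` ⟹ `g(ad(−X))` invertible, `‖g(ad(−X)) − 1‖ ≤ (e^{2‖X‖} − 1)∕2`), ★`hasFDerivAt_mlog_exp_mul_exp_neg` (`HasFDerivAt (A ↦ log(e^{A}e^{−X})) (g(ad(−X))) X`).
* §2 (the T³ member, bond fields `PBond (F.P K) 0 → M₂(ℂ)`): ★`hasDerivAt_chartCurve_mul_star` (the bond form of the velocity letter for `U′ b = e^{A₁ b}U₀ b`), ★★`hasFDerivAt_rebaseLog`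
  (`HasFDerivAt (A ↦ (b ↦ log(e^{A b}e^{−A₁ b}))) (pi_b g(ad(−A₁ b)) ∘ proj_b) A₁`), `expUnit_rebaseLog_mul_bgUnits` (`e^{Ã(A)(b)}·U′♭(b) = e^{A(b)}·U₀♭(b)` inside the `log` window),
  ★★★`hasFDerivAt_rel_rebase` — if the relative average based at `U′`, `Ã ↦ D̄(e^{Ã}U′)D̄(U′)⁻¹`, has derivative `G′` at `0`, then `A ↦ D̄(e^{A}U₀)D̄(U₀)⁻¹` has derivative
  `α ↦ (G′(Mα))·(D̄(U′)D̄(U₀)⁻¹)` at `A₁` (eventual equality of the two functions near `A₁` + chain rule), `rel_rebase_fderiv_apply` (that derivative, applied); small identities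
  `mlog_exp_mul_exp_neg_self`, `rebaseLog_self`.
* §3 ★★★`hasDerivAt_wilsonAction4_chartCurve` — `d∕dt|₀ 𝒜(e^{c(t)}U₀) = Lin_{U′}(b ↦ g(ad(−A₁ b))(ċ(0) b))` for any exponent curve `c` through `A₁` whose configurations are `SU(2)`-valued: the
  dictionary that turns curve-form slice-criticality in `U₀`'s chart ([Balaban1985Variational] (93)) into the `T`∕`hT` input of ★★`Prop7TangentCriticalSplit.tangentCritical_su2_of_split`.
HONEST SCOPE: calculus over landed letters; no estimate of print, no window; the knit's objects (`QTwS`, `frameTwS`, the (47)-map) are not touched here — T2 (the tangent space of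
the twisted slice at `A₁`) and the transport of the split are the sequel.

References: T. Bałaban, CMP 98 (1985) 17–51 [Balaban1985Averaging] ((32)–(34) pp.22–23, (11) p.19); CMP 102 (1985) 277–309 [Balaban1985Variational] ((47)–(49) p.285, (82)–(83) p.290,
p.299); V. S. Varadarajan, GTM 102, Thm 2.14.3; B. C. Hall, GTM 222, Thm 5.4.
-/

set_option autoImplicit false

noncomputable section

open scoped BigOperators Matrix.Norms.L2Operator Matrix Topology
open Filter

namespace Summit.QuantumFields.YangMills.Theorems.Prop7ChartVelocityDexp

open NormedSpace
open Literature.Analysis.Calculus.ExpDifferential (ad ad_apply gSer dexp dexp_apply exp_ad_apply exp_ad_mul_gSer_ad hasFDerivAt_exp_dexp hasDerivAt_exp_comp_gSer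
  isUnit_gSer norm_gSer_sub_one_le norm_ad_le exp_neg_mul_exp_eq_one exp_mul_exp_neg_eq_one)
open Literature.MathematicalPhysics.QuantumFieldTheory.Balaban1983to89
open Literature.MathematicalPhysics.QuantumFieldTheory.Balaban1983to89.T3ContinuumYM3Torus
open Literature.MathematicalPhysics.QuantumFieldTheory.Balaban1983to89.T3SectALandauChart (bgUnits)
open B7Prop1Explicit (expUnit val_expUnit)
open MatrixLog (mlog mlog_one exp_mlog)
open B7TransferAnalyticMean (hasFDerivAt_mlog_one)
open Summit.QuantumFields.YangMills.Theorems.Prop7SymAvgGL (descendToGL)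
open Summit.QuantumFields.YangMills.Theorems.Prop7Growth142T3ChartELStat (hasDerivAt_wilsonAction4_of_hasDerivAt_mulStar)

/-! ## §1 The trivialised differential of `exp` at a non-zero point (any complete normed `ℂ`-algebra) -/

section Algebra

variable {𝔸 : Type*} [NormedRing 𝔸] [NormedAlgebra ℂ 𝔸] [CompleteSpace 𝔸]

/-- **`Dexp_X(h)·e^{−X} = g(ad(−X))h`**: the RIGHT-trivialised differential of the exponential (`Dexp_X(h) = e^{X}·g(ad X)h`, `e^{X}·Y·e^{−X} = e^{ad X}Y`, `e^{ad X}g(ad X) = g(ad(−X))`).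
[cite: Balaban1985Averaging, (32)-(34) pp.22-23] -/
theorem dexp_apply_mul_exp_neg (X h : 𝔸) : dexp ℂ X h * exp (-X) = gSer ℂ (ad ℂ (-X)) h := by
  rw [dexp_apply, ← exp_ad_mul_gSer_ad (𝕂 := ℂ) X]
  show _ = exp (ad ℂ X) (gSer ℂ (ad ℂ X) h)
  rw [exp_ad_apply]

/-- ★ **`d∕dt|₀ (e^{X + tα}·P) = e^{X}·g(ad X)α·P`** for a real parameter `t` (the curve is affine in `ℂ`, then restricted to `ℝ`). [cite: Balaban1985Averaging, (32) p.22] -/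
theorem hasDerivAt_exp_add_smul_mul (X α P : 𝔸) :
    HasDerivAt (fun t : ℝ => exp (X + t • α) * P) (exp X * gSer ℂ (ad ℂ X) α * P) 0 := by
  have hline : HasDerivAt (fun s : ℂ => X + s • α) α 0 := by
    simpa using ((hasDerivAt_id (0 : ℂ)).smul_const α).const_add X
  have hexp : HasDerivAt (fun s : ℂ => exp (X + s • α) * P) (exp X * gSer ℂ (ad ℂ X) α * P) (Complex.ofRealCLM (0 : ℝ)) := by
    have h1 := (hasDerivAt_exp_comp_gSer (𝕂 := ℂ) hline).mul_const P
    simp only [zero_smul, add_zero] at h1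
    rw [Complex.ofRealCLM_apply, Complex.ofReal_zero]
    exact h1
  have hof : HasDerivAt (Complex.ofRealCLM : ℝ → ℂ) (Complex.ofRealCLM 1) 0 := Complex.ofRealCLM.hasDerivAt
  have h := (hexp.scomp (0 : ℝ) hof).congr_deriv (by rw [Complex.ofRealCLM_apply, Complex.ofReal_one, one_smul])
  have hfun : (fun t : ℝ => exp (X + t • α) * P) = ((fun s : ℂ => exp (X + s • α) * P) ∘ (Complex.ofRealCLM : ℝ → ℂ)) := by
    funext t; simp only [Function.comp_apply, Complex.ofRealCLM_apply, Complex.coe_smul]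
  rw [hfun]
  exact h

/-- ★★ **THE VELOCITY LETTER**: for `Xᴴ = −X` (so `e^{X}` is unitary) and `P·Pᴴ = 1`: `d∕dt|₀ e^{X + tα}·P·(e^{X}·P)ᴴ = g(ad(−X))α` — the right-trivialised velocity at the chart point `e^{X}P`
of the chart curve through it in the direction `α`. [cite: Balaban1985Averaging, (32)-(34) pp.22-23; Balaban1985Variational, (82)-(83) p.290] -/
theorem hasDerivAt_exp_add_smul_mul_mul_star [StarRing 𝔸] [ContinuousStar 𝔸] {X P : 𝔸} (hX : star X = -X) (hP : P * star P = 1) (α : 𝔸) :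
    HasDerivAt (fun t : ℝ => exp (X + t • α) * P * star (exp X * P)) (gSer ℂ (ad ℂ (-X)) α) 0 := by
  have h := (hasDerivAt_exp_add_smul_mul X α P).mul_const (star (exp X * P))
  have hval : exp X * gSer ℂ (ad ℂ X) α * P * star (exp X * P) = gSer ℂ (ad ℂ (-X)) α := by
    rw [star_mul, star_exp, hX, mul_assoc (exp X * gSer ℂ (ad ℂ X) α), ← mul_assoc P, hP, one_mul, ← dexp_apply, dexp_apply_mul_exp_neg]
  rw [hval] at h
  exact h

/-- ★★ **THE VELOCITY LETTER ALONG ANY DIFFERENTIABLE EXPONENT CURVE**: if `c : ℝ → 𝔸` has derivative `α` at `0`, `c(0)ᴴ = −c(0)` and `P·Pᴴ = 1`, then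
`d∕dt|₀ e^{c(t)}·P·(e^{c(0)}·P)ᴴ = g(ad(−c(0)))α` (chain rule through ✓`hasFDerivAt_exp_dexp` restricted to `ℝ`; the (47)-chart curves `t ↦ χ(A′₁ + tδ)` are of this kind).
[cite: Balaban1985Averaging, (32)-(34) pp.22-23; Balaban1985Variational, (47) p.285, (82)-(83) p.290] -/
theorem hasDerivAt_exp_comp_mul_mul_star [StarRing 𝔸] [ContinuousStar 𝔸] {c : ℝ → 𝔸} {α P : 𝔸} (hc : HasDerivAt c α 0) (hX : star (c 0) = -c 0)
    (hP : P * star P = 1) :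
    HasDerivAt (fun t : ℝ => exp (c t) * P * star (exp (c 0) * P)) (gSer ℂ (ad ℂ (-c 0)) α) 0 := by
  have hexp : HasDerivAt (fun t : ℝ => exp (c t)) (dexp ℂ (c 0) α) 0 := by
    have h := ((hasFDerivAt_exp_dexp (𝕂 := ℂ) (c 0)).restrictScalars ℝ).comp_hasDerivAt (0 : ℝ) hc
    exact h
  have h := (hexp.mul_const P).mul_const (star (exp (c 0) * P))
  have hval : dexp ℂ (c 0) α * P * star (exp (c 0) * P) = gSer ℂ (ad ℂ (-c 0)) α := by
    rw [star_mul, star_exp, hX, mul_assoc (dexp ℂ (c 0) α), ← mul_assoc P, hP, one_mul, dexp_apply_mul_exp_neg]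
  rw [hval] at h
  exact h

/-- ★ **`g(ad(−X))` IS INVERTIBLE FOR `‖X‖ ≤ ½`** (`‖ad(−X)‖ ≤ 2‖X‖ ≤ 1`, (34)). [cite: Balaban1985Averaging, (34) p.23] -/
theorem isUnit_gSer_ad_neg {X : 𝔸} (hX : ‖X‖ ≤ 1 / 2) : IsUnit (gSer ℂ (ad ℂ (-X))) := by
  refine isUnit_gSer ?_
  calc ‖ad ℂ (-X)‖ ≤ 2 * ‖-X‖ := norm_ad_le (𝕂 := ℂ) (-X)
    _ = 2 * ‖X‖ := by rw [norm_neg]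
    _ ≤ 1 := by linarith

/-- **`‖g(ad(−X)) − 1‖ ≤ (e^{2‖X‖} − 1)∕2`** — the velocity map is a small perturbation of the identity (Neumann-ready). [cite: Balaban1985Averaging, (34) p.23] -/
theorem norm_gSer_ad_neg_sub_one_le (X : 𝔸) : ‖gSer ℂ (ad ℂ (-X)) - 1‖ ≤ (Real.exp (2 * ‖X‖) - 1) / 2 := by
  refine (norm_gSer_sub_one_le (𝕂 := ℂ) (ad ℂ (-X))).trans ?_
  have h1 : ‖ad ℂ (-X)‖ ≤ 2 * ‖X‖ := by
    calc ‖ad ℂ (-X)‖ ≤ 2 * ‖-X‖ := norm_ad_le (𝕂 := ℂ) (-X)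
      _ = 2 * ‖X‖ := by rw [norm_neg]
  have h2 : Real.exp ‖ad ℂ (-X)‖ ≤ Real.exp (2 * ‖X‖) := Real.exp_le_exp.2 h1
  linarith

/-- ★ **RE-BASING THE EXPONENT, DERIVATIVE**: `A ↦ log(e^{A}·e^{−X})` has derivative `g(ad(−X))` at `A = X` (`e^{X}e^{−X} = 1`, `log′(1) = id`, `Dexp_X(h)·e^{−X} = g(ad(−X))h`).
[cite: Balaban1985Averaging, (32)-(34) pp.22-23] -/
theorem hasFDerivAt_mlog_exp_mul_exp_neg (X : 𝔸) :
    HasFDerivAt (fun A : 𝔸 => mlog (exp A * exp (-X))) (gSer ℂ (ad ℂ (-X))) X := by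
  have hexp := (hasFDerivAt_exp_dexp (𝕂 := ℂ) X).mul_const' (exp (-X))
  have hlog : HasFDerivAt (mlog : 𝔸 → 𝔸) (1 : 𝔸 →L[ℂ] 𝔸) (exp X * exp (-X)) := by
    rw [exp_mul_exp_neg_eq_one (𝕂 := ℂ) X]; exact hasFDerivAt_mlog_one
  have hcomp := hlog.comp X hexp
  refine hcomp.congr_fderiv (ContinuousLinearMap.ext fun Y => ?_)
  rw [ContinuousLinearMap.coe_comp, Function.comp_apply, ContinuousLinearMap.one_def, ContinuousLinearMap.coe_id', id, smul_apply, op_smul_eq_mul]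
  exact dexp_apply_mul_exp_neg X Y

/-- `log(e^{X}e^{−X}) = 0`. [folklore] -/
theorem mlog_exp_mul_exp_neg_self (X : 𝔸) : mlog (exp X * exp (-X)) = 0 := by
  rw [exp_mul_exp_neg_eq_one (𝕂 := ℂ) X, mlog_one]

end Algebra

/-! ## §2 The T³ member: the velocity letter on the route's carriers and the re-based relative average -/

section Member

open scoped RightActions

variable (F : T3Family) {n K : ℕ} (h : n ≤ K)

/-- ★ **THE BOND FORM OF THE VELOCITY LETTER**: for `SU(2)`-valued `U₀`, `U′` with `U′(b) = e^{A₁(b)}U₀(b)` and `A₁(b)ᴴ = −A₁(b)`, the right-trivialised bond velocity at `U′` of the chart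
curve `t ↦ e^{A₁ + tα}U₀` is `g(ad(−A₁(b)))(α(b))` — the letter `hγtξ`∕`hγξ` of ✓`hasDerivAt_wilsonAction4_of_hasDerivAt_mulStar`. [cite: Balaban1985Averaging, (32)-(34) pp.22-23; Balaban1985Variational, (82)-(83) p.290] -/
theorem hasDerivAt_chartCurve_mul_star (U₀ U' : GaugeField (F.P K) 0 (Matrix.specialUnitaryGroup (Fin 2) ℂ)) (A₁ α : PBond (F.P K) 0 → Matrix (Fin 2) (Fin 2) ℂ)
    (hA₁ : ∀ b, star (A₁ b) = -A₁ b) (hU' : ∀ b, ((U' b : Matrix.specialUnitaryGroup (Fin 2) ℂ) : Matrix (Fin 2) (Fin 2) ℂ) = exp (A₁ b) * ((U₀ b : Matrix.specialUnitaryGroup (Fin 2) ℂ) : Matrix (Fin 2) (Fin 2) ℂ))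
    (b : PBond (F.P K) 0) :
    HasDerivAt (fun t : ℝ => exp (A₁ b + t • α b) * ((U₀ b : Matrix.specialUnitaryGroup (Fin 2) ℂ) : Matrix (Fin 2) (Fin 2) ℂ)
        * star ((U' b : Matrix.specialUnitaryGroup (Fin 2) ℂ) : Matrix (Fin 2) (Fin 2) ℂ)) (gSer ℂ (ad ℂ (-A₁ b)) (α b)) 0 := by
  have hP : ((U₀ b : Matrix.specialUnitaryGroup (Fin 2) ℂ) : Matrix (Fin 2) (Fin 2) ℂ) * star ((U₀ b : Matrix.specialUnitaryGroup (Fin 2) ℂ) : Matrix (Fin 2) (Fin 2) ℂ) = 1 :=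
    (Matrix.mem_unitaryGroup_iff).1 (Matrix.mem_specialUnitaryGroup_iff.1 (U₀ b).2).1
  have h1 := hasDerivAt_exp_add_smul_mul_mul_star (hA₁ b) hP (α b)
  simp only [← hU'] at h1
  exact h1

/-- ★★ **RE-BASING THE EXPONENT FIELD, DERIVATIVE**: `Ã : A ↦ (b ↦ log(e^{A(b)}e^{−A₁(b)}))` has derivative `M = (α ↦ (b ↦ g(ad(−A₁(b)))α(b)))` at `A₁` (bondwise §1).
[cite: Balaban1985Averaging, (32)-(34) pp.22-23] -/
theorem hasFDerivAt_rebaseLog (A₁ : PBond (F.P K) 0 → Matrix (Fin 2) (Fin 2) ℂ) :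
    HasFDerivAt (fun A : PBond (F.P K) 0 → Matrix (Fin 2) (Fin 2) ℂ => fun b : PBond (F.P K) 0 => mlog (exp (A b) * exp (-A₁ b)))
      (ContinuousLinearMap.pi fun b : PBond (F.P K) 0 => (gSer ℂ (ad ℂ (-A₁ b))).comp (ContinuousLinearMap.proj b)) A₁ := by
  apply hasFDerivAt_pi''
  intro b
  have hout := hasFDerivAt_mlog_exp_mul_exp_neg (A₁ b)
  have hin : HasFDerivAt (fun A : PBond (F.P K) 0 → Matrix (Fin 2) (Fin 2) ℂ => A b) (ContinuousLinearMap.proj b) A₁ :=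
    (ContinuousLinearMap.proj (R := ℂ) (φ := fun _ : PBond (F.P K) 0 => Matrix (Fin 2) (Fin 2) ℂ) b).hasFDerivAt
  have hcomp := hout.comp A₁ hin
  refine hcomp.congr_fderiv (ContinuousLinearMap.ext fun Y => ?_)
  simp only [ContinuousLinearMap.coe_comp, Function.comp_apply, ContinuousLinearMap.proj_apply, ContinuousLinearMap.pi_apply]

/-- `Ã(A₁) = 0`. [folklore] -/
theorem rebaseLog_self (A₁ : PBond (F.P K) 0 → Matrix (Fin 2) (Fin 2) ℂ) :
    (fun b : PBond (F.P K) 0 => mlog (exp (A₁ b) * exp (-A₁ b))) = 0 := by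
  funext b; exact mlog_exp_mul_exp_neg_self (A₁ b)

/-- **`e^{Ã(A)(b)}·U′♭(b) = e^{A(b)}·U₀♭(b)` INSIDE THE `log` WINDOW** (`‖e^{A(b)}e^{−A₁(b)} − 1‖ < 1`): the configuration `e^{A}U₀` read in the chart based at `U′ = e^{A₁}U₀`.
[cite: Balaban1985Variational, (47)-(49) p.285, p.299] -/
theorem expUnit_rebaseLog_mul_bgUnits (U₀ U' : GaugeField (F.P K) 0 (Matrix.specialUnitaryGroup (Fin 2) ℂ)) (A₁ A : PBond (F.P K) 0 → Matrix (Fin 2) (Fin 2) ℂ)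
    (hU' : ∀ b, ((U' b : Matrix.specialUnitaryGroup (Fin 2) ℂ) : Matrix (Fin 2) (Fin 2) ℂ) = exp (A₁ b) * ((U₀ b : Matrix.specialUnitaryGroup (Fin 2) ℂ) : Matrix (Fin 2) (Fin 2) ℂ))
    (b : PBond (F.P K) 0) (hb : ‖exp (A b) * exp (-A₁ b) - 1‖ < 1) :
    expUnit (mlog (exp (A b) * exp (-A₁ b))) * bgUnits F K U' b = expUnit (A b) * bgUnits F K U₀ b := by
  apply Units.ext
  rw [Units.val_mul, Units.val_mul, val_expUnit, val_expUnit]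
  show exp (mlog (exp (A b) * exp (-A₁ b))) * ((U' b : Matrix.specialUnitaryGroup (Fin 2) ℂ) : Matrix (Fin 2) (Fin 2) ℂ)
      = exp (A b) * ((U₀ b : Matrix.specialUnitaryGroup (Fin 2) ℂ) : Matrix (Fin 2) (Fin 2) ℂ)
  rw [exp_mlog hb, hU', mul_assoc, ← mul_assoc (exp (-A₁ b)), exp_neg_mul_exp_eq_one (𝕂 := ℂ), one_mul]

/-- ★★★ **THE RELATIVE AVERAGE RE-BASED FROM `U₀` TO THE CHART POINT `U′ = e^{A₁}U₀`.**  Let `G′` be the derivative at `0` of the relative `(M₂)ˣ`-average based at `U′`,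
`Ã ↦ D̄(e^{Ã}U′)·D̄(U′)⁻¹` (the `hG` letter of ✓`Prop7FibreELOfTangentCritical.fibreEL_of_tangentCritical(_su2)` AT `U′`; at printed-regular `U′` it is ✓`hasFDerivAt_rel_of_regPr`).  Then the
`U₀`-based relative average `A ↦ D̄(e^{A}U₀)·D̄(U₀)⁻¹` is differentiable AT `A₁` with derivative `α ↦ (c ↦ G′(Mα)(c)·[D̄(U′)(c)·D̄(U₀)(c)⁻¹])`, `M` the velocity map of `hasFDerivAt_rebaseLog`: near `A₁`
the two configurations `e^{A}U₀` and `e^{Ã(A)}U′` COINCIDE (`expUnit_rebaseLog_mul_bgUnits`), so the functions agree eventually, and the chain rule through `Ã` (`Ã(A₁) = 0`) applies.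
[cite: Balaban1985Averaging, (11) p.19, (32)-(34) pp.22-23; Balaban1985Variational, (44) p.285, (82)-(83) p.290, p.299] -/
theorem hasFDerivAt_rel_rebase (U₀ U' : GaugeField (F.P K) 0 (Matrix.specialUnitaryGroup (Fin 2) ℂ)) (A₁ : PBond (F.P K) 0 → Matrix (Fin 2) (Fin 2) ℂ)
    (hU' : ∀ b, ((U' b : Matrix.specialUnitaryGroup (Fin 2) ℂ) : Matrix (Fin 2) (Fin 2) ℂ) = exp (A₁ b) * ((U₀ b : Matrix.specialUnitaryGroup (Fin 2) ℂ) : Matrix (Fin 2) (Fin 2) ℂ))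
    {G' : (PBond (F.P K) 0 → Matrix (Fin 2) (Fin 2) ℂ) →L[ℂ] (PBond (F.P n) 0 → Matrix (Fin 2) (Fin 2) ℂ)}
    (hG : HasFDerivAt (fun A : PBond (F.P K) 0 → Matrix (Fin 2) (Fin 2) ℂ => fun c : PBond (F.P n) 0 =>
        ((descendToGL F n K h (fun b => expUnit (A b) * bgUnits F K U' b) c : (Matrix (Fin 2) (Fin 2) ℂ)ˣ) : Matrix (Fin 2) (Fin 2) ℂ) *
          (((descendToGL F n K h (bgUnits F K U') c)⁻¹ : (Matrix (Fin 2) (Fin 2) ℂ)ˣ) : Matrix (Fin 2) (Fin 2) ℂ)) G' 0) :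
    HasFDerivAt (fun A : PBond (F.P K) 0 → Matrix (Fin 2) (Fin 2) ℂ => fun c : PBond (F.P n) 0 =>
        ((descendToGL F n K h (fun b => expUnit (A b) * bgUnits F K U₀ b) c : (Matrix (Fin 2) (Fin 2) ℂ)ˣ) : Matrix (Fin 2) (Fin 2) ℂ) *
          (((descendToGL F n K h (bgUnits F K U₀) c)⁻¹ : (Matrix (Fin 2) (Fin 2) ℂ)ˣ) : Matrix (Fin 2) (Fin 2) ℂ))
      (ContinuousLinearMap.pi fun c : PBond (F.P n) 0 =>
        ((ContinuousLinearMap.proj c).comp (G'.comp (ContinuousLinearMap.pi fun b : PBond (F.P K) 0 => (gSer ℂ (ad ℂ (-A₁ b))).comp (ContinuousLinearMap.proj b))))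
          <• (((descendToGL F n K h (bgUnits F K U') c : (Matrix (Fin 2) (Fin 2) ℂ)ˣ) : Matrix (Fin 2) (Fin 2) ℂ) *
              (((descendToGL F n K h (bgUnits F K U₀) c)⁻¹ : (Matrix (Fin 2) (Fin 2) ℂ)ˣ) : Matrix (Fin 2) (Fin 2) ℂ))) A₁ := by
  -- opaque names for the `U′`-based relative average and the constant right factor
  obtain ⟨R, hR⟩ : ∃ R : PBond (F.P n) 0 → Matrix (Fin 2) (Fin 2) ℂ, R = fun c : PBond (F.P n) 0 =>
      ((descendToGL F n K h (bgUnits F K U') c : (Matrix (Fin 2) (Fin 2) ℂ)ˣ) : Matrix (Fin 2) (Fin 2) ℂ) *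
        (((descendToGL F n K h (bgUnits F K U₀) c)⁻¹ : (Matrix (Fin 2) (Fin 2) ℂ)ˣ) : Matrix (Fin 2) (Fin 2) ℂ) := ⟨_, rfl⟩
  obtain ⟨rel', hrel'⟩ : ∃ rel' : (PBond (F.P K) 0 → Matrix (Fin 2) (Fin 2) ℂ) → (PBond (F.P n) 0 → Matrix (Fin 2) (Fin 2) ℂ),
      rel' = fun A : PBond (F.P K) 0 → Matrix (Fin 2) (Fin 2) ℂ => fun c : PBond (F.P n) 0 =>
        ((descendToGL F n K h (fun b => expUnit (A b) * bgUnits F K U' b) c : (Matrix (Fin 2) (Fin 2) ℂ)ˣ) : Matrix (Fin 2) (Fin 2) ℂ) *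
          (((descendToGL F n K h (bgUnits F K U') c)⁻¹ : (Matrix (Fin 2) (Fin 2) ℂ)ˣ) : Matrix (Fin 2) (Fin 2) ℂ) := ⟨_, rfl⟩
  rw [← hrel'] at hG
  set Ã : (PBond (F.P K) 0 → Matrix (Fin 2) (Fin 2) ℂ) → (PBond (F.P K) 0 → Matrix (Fin 2) (Fin 2) ℂ) :=
    fun A b => mlog (exp (A b) * exp (-A₁ b)) with hÃ
  set Mm : (PBond (F.P K) 0 → Matrix (Fin 2) (Fin 2) ℂ) →L[ℂ] (PBond (F.P K) 0 → Matrix (Fin 2) (Fin 2) ℂ) :=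
    ContinuousLinearMap.pi fun b : PBond (F.P K) 0 => (gSer ℂ (ad ℂ (-A₁ b))).comp (ContinuousLinearMap.proj b) with hMm
  -- the chain rule through `Ã`
  have hÃd : HasFDerivAt Ã Mm A₁ := hasFDerivAt_rebaseLog F A₁
  have hÃ0 : Ã A₁ = 0 := rebaseLog_self F A₁
  have hG0 : HasFDerivAt rel' G' (Ã A₁) := by rw [hÃ0]; exact hG
  have hcomp : HasFDerivAt (rel' ∘ Ã) (G'.comp Mm) A₁ := hG0.comp A₁ hÃd
  -- multiply coordinatewise by the constant `R c`
  have hprod : HasFDerivAt (fun A : PBond (F.P K) 0 → Matrix (Fin 2) (Fin 2) ℂ => fun c : PBond (F.P n) 0 => (rel' (Ã A)) c * R c)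
      (ContinuousLinearMap.pi fun c : PBond (F.P n) 0 => ((ContinuousLinearMap.proj c).comp (G'.comp Mm)) <• R c) A₁ := by
    apply hasFDerivAt_pi''
    intro c
    have hc : HasFDerivAt (fun A : PBond (F.P K) 0 → Matrix (Fin 2) (Fin 2) ℂ => (rel' (Ã A)) c) ((ContinuousLinearMap.proj c).comp (G'.comp Mm)) A₁ :=
      (hasFDerivAt_pi'.1 hcomp) c
    have hc' := hc.mul_const' (R c)
    refine hc'.congr_fderiv ?_
    rw [ContinuousLinearMap.proj_pi]
  -- the two functions agree near `A₁`
  have hwin : ∀ᶠ A in 𝓝 A₁, ∀ b : PBond (F.P K) 0, ‖exp (A b) * exp (-A₁ b) - 1‖ < 1 := by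
    refine eventually_all.2 fun b => ?_
    have hev : ContinuousAt (fun A : PBond (F.P K) 0 → Matrix (Fin 2) (Fin 2) ℂ => A b) A₁ := (continuous_apply b).continuousAt
    have hexpc : ContinuousAt (exp : Matrix (Fin 2) (Fin 2) ℂ → Matrix (Fin 2) (Fin 2) ℂ) (A₁ b) := (hasFDerivAt_exp_dexp (𝕂 := ℂ) (A₁ b)).continuousAt
    have hcomp' : ContinuousAt (fun A : PBond (F.P K) 0 → Matrix (Fin 2) (Fin 2) ℂ => exp (A b)) A₁ := ContinuousAt.comp (g := exp) hexpc hev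
    have hcont : ContinuousAt (fun A : PBond (F.P K) 0 → Matrix (Fin 2) (Fin 2) ℂ => exp (A b) * exp (-A₁ b)) A₁ := hcomp'.mul continuousAt_const
    have h1 : exp (A₁ b) * exp (-A₁ b) = 1 := exp_mul_exp_neg_eq_one (𝕂 := ℂ) (A₁ b)
    have ht := Metric.tendsto_nhds.1 hcont 1 one_pos
    simp only [h1] at ht
    filter_upwards [ht] with A hA
    rwa [dist_eq_norm] at hA
  have heq : (fun A : PBond (F.P K) 0 → Matrix (Fin 2) (Fin 2) ℂ => fun c : PBond (F.P n) 0 =>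
        ((descendToGL F n K h (fun b => expUnit (A b) * bgUnits F K U₀ b) c : (Matrix (Fin 2) (Fin 2) ℂ)ˣ) : Matrix (Fin 2) (Fin 2) ℂ) *
          (((descendToGL F n K h (bgUnits F K U₀) c)⁻¹ : (Matrix (Fin 2) (Fin 2) ℂ)ˣ) : Matrix (Fin 2) (Fin 2) ℂ))
      =ᶠ[𝓝 A₁] fun A => fun c => (rel' (Ã A)) c * R c := by
    filter_upwards [hwin] with A hA
    have hcfg : (fun b => expUnit (A b) * bgUnits F K U₀ b) = fun b => expUnit (Ã A b) * bgUnits F K U' b :=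
      funext fun b => (expUnit_rebaseLog_mul_bgUnits F U₀ U' A₁ A hU' b (hA b)).symm
    funext c
    rw [hrel', hR, hcfg]
    show _ = ((descendToGL F n K h (fun b => expUnit (Ã A b) * bgUnits F K U' b) c : (Matrix (Fin 2) (Fin 2) ℂ)ˣ) : Matrix (Fin 2) (Fin 2) ℂ) *
          (((descendToGL F n K h (bgUnits F K U') c)⁻¹ : (Matrix (Fin 2) (Fin 2) ℂ)ˣ) : Matrix (Fin 2) (Fin 2) ℂ) *
        (((descendToGL F n K h (bgUnits F K U') c : (Matrix (Fin 2) (Fin 2) ℂ)ˣ) : Matrix (Fin 2) (Fin 2) ℂ) *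
          (((descendToGL F n K h (bgUnits F K U₀) c)⁻¹ : (Matrix (Fin 2) (Fin 2) ℂ)ˣ) : Matrix (Fin 2) (Fin 2) ℂ))
    rw [← Units.val_mul, ← Units.val_mul, ← Units.val_mul, ← Units.val_mul, mul_assoc, ← mul_assoc ((descendToGL F n K h (bgUnits F K U') c)⁻¹),
      inv_mul_cancel, one_mul]
  have hfinal := hprod.congr_of_eventuallyEq heq
  rw [hR] at hfinal
  exact hfinal

/-- The re-based derivative, APPLIED: `D[A ↦ D̄(e^{A}U₀)D̄(U₀)⁻¹](A₁)(α)(c) = G′(b ↦ g(ad(−A₁ b))α(b))(c)·D̄(U′)(c)·D̄(U₀)(c)⁻¹`. [cite: Balaban1985Averaging, (11) p.19, (32)-(34) pp.22-23] -/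
theorem rel_rebase_fderiv_apply (U₀ U' : GaugeField (F.P K) 0 (Matrix.specialUnitaryGroup (Fin 2) ℂ)) (A₁ : PBond (F.P K) 0 → Matrix (Fin 2) (Fin 2) ℂ)
    (G' : (PBond (F.P K) 0 → Matrix (Fin 2) (Fin 2) ℂ) →L[ℂ] (PBond (F.P n) 0 → Matrix (Fin 2) (Fin 2) ℂ))
    (α : PBond (F.P K) 0 → Matrix (Fin 2) (Fin 2) ℂ) (c : PBond (F.P n) 0) :
    (ContinuousLinearMap.pi fun c : PBond (F.P n) 0 =>
        ((ContinuousLinearMap.proj c).comp (G'.comp (ContinuousLinearMap.pi fun b : PBond (F.P K) 0 => (gSer ℂ (ad ℂ (-A₁ b))).comp (ContinuousLinearMap.proj b))))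
          <• (((descendToGL F n K h (bgUnits F K U') c : (Matrix (Fin 2) (Fin 2) ℂ)ˣ) : Matrix (Fin 2) (Fin 2) ℂ) *
              (((descendToGL F n K h (bgUnits F K U₀) c)⁻¹ : (Matrix (Fin 2) (Fin 2) ℂ)ˣ) : Matrix (Fin 2) (Fin 2) ℂ))) α c
      = G' (fun b => gSer ℂ (ad ℂ (-A₁ b)) (α b)) c *
          (((descendToGL F n K h (bgUnits F K U') c : (Matrix (Fin 2) (Fin 2) ℂ)ˣ) : Matrix (Fin 2) (Fin 2) ℂ) *
            (((descendToGL F n K h (bgUnits F K U₀) c)⁻¹ : (Matrix (Fin 2) (Fin 2) ℂ)ˣ) : Matrix (Fin 2) (Fin 2) ℂ)) := by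
  simp only [ContinuousLinearMap.pi_apply, smul_apply, ContinuousLinearMap.coe_comp, Function.comp_apply, ContinuousLinearMap.proj_apply,
    op_smul_eq_mul]
  rfl

/-! ## §3 The first variation of the Wilson action along a chart curve through `U′` -/

/-- ★★★ **`d∕dt|₀ 𝒜(e^{c(t)}·U₀) = Lin_{U′}(ξ)`, `ξ(b) = g(ad(−A₁(b)))(ċ(0)(b))`** — THE DICTIONARY BETWEEN CURVE-FORM SLICE-CRITICALITY IN `U₀`'s CHART AND `Lin` AT THE CHART POINT.  `U₀`, `U′`
`SU(2)`-valued with `U′(b) = e^{A₁(b)}U₀(b)`, `A₁(b)ᴴ = −A₁(b)`; `c : ℝ → (bonds → M₂)` an exponent curve with `c(0) = A₁`, bondwise differentiable at `0` with velocity `α`; `Γ` the `SU(2)`-configuration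
curve with `Γ(t)(b) = e^{c(t)(b)}U₀(b)` (its `SU(2)`-valuedness is the caller's: for the (47)-chart curves `c(t) = χ(A′₁ + tδ)`, `δ` real, it is print's (51) — ✓`chartExponentTwS_mem_of_ball_of_regPr`).
Then `t ↦ 𝒜(Γ(t))` has derivative `Lin_{U′}(b ↦ g(ad(−A₁ b))(α b))` at `0` (✓`hasDerivAt_wilsonAction4_of_hasDerivAt_mulStar` fed with §2's velocity letter).  So a displayed row «`deriv (𝒜 ∘ Γ_δ) 0 = 0` for the
slice directions `δ`» ([Balaban1985Variational] (93) read at the solution of (111)) is the SAME as «`Lin_{U′}` vanishes on `T := {b ↦ g(ad(−A₁ b))((Dχ(A′₁)δ) b)}`» — the `T`∕`hT` input of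
★★`Prop7TangentCriticalSplit.tangentCritical_su2_of_split`. [cite: Balaban1985Variational, (26)-(27) p.282, (82)-(83) p.290, (93) p.291, (47) p.285; Balaban1985Averaging, (32)-(34) pp.22-23] -/
theorem hasDerivAt_wilsonAction4_chartCurve (U₀ U' : GaugeField (F.P K) 0 (Matrix.specialUnitaryGroup (Fin 2) ℂ)) (A₁ : PBond (F.P K) 0 → Matrix (Fin 2) (Fin 2) ℂ)
    (hA₁ : ∀ b, star (A₁ b) = -A₁ b) (hU' : ∀ b, ((U' b : Matrix.specialUnitaryGroup (Fin 2) ℂ) : Matrix (Fin 2) (Fin 2) ℂ) = exp (A₁ b) * ((U₀ b : Matrix.specialUnitaryGroup (Fin 2) ℂ) : Matrix (Fin 2) (Fin 2) ℂ))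
    (c : ℝ → PBond (F.P K) 0 → Matrix (Fin 2) (Fin 2) ℂ) (α : PBond (F.P K) 0 → Matrix (Fin 2) (Fin 2) ℂ) (hc0 : c 0 = A₁)
    (hcd : ∀ b : PBond (F.P K) 0, HasDerivAt (fun t : ℝ => c t b) (α b) 0)
    (Γ : ℝ → GaugeField (F.P K) 0 (Matrix.specialUnitaryGroup (Fin 2) ℂ))
    (hΓ : ∀ t b, ((Γ t b : Matrix.specialUnitaryGroup (Fin 2) ℂ) : Matrix (Fin 2) (Fin 2) ℂ) = exp (c t b) * ((U₀ b : Matrix.specialUnitaryGroup (Fin 2) ℂ) : Matrix (Fin 2) (Fin 2) ℂ)) :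
    HasDerivAt (fun t : ℝ => wilsonAction4 (Γ t))
      (∑ p : Plaq (F.P K) 0, (1 / 2) * ((((((GaugeField.plaqHol U' p : Matrix.specialUnitaryGroup (Fin 2) ℂ) : Matrix (Fin 2) (Fin 2) ℂ)) - 1)ᴴ
          * (((fun b : PBond (F.P K) 0 => gSer ℂ (ad ℂ (-A₁ b)) (α b)) ⟨p.src, p.μ⟩
              + (U' ⟨p.src, p.μ⟩ : Matrix (Fin 2) (Fin 2) ℂ) * (fun b : PBond (F.P K) 0 => gSer ℂ (ad ℂ (-A₁ b)) (α b)) ⟨p.src.shift p.μ, p.ν⟩ * star (U' ⟨p.src, p.μ⟩ : Matrix (Fin 2) (Fin 2) ℂ)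
              - ((U' ⟨p.src, p.μ⟩ * U' ⟨p.src.shift p.μ, p.ν⟩ * (U' ⟨p.src.shift p.ν, p.μ⟩)⁻¹ : Matrix.specialUnitaryGroup (Fin 2) ℂ) : Matrix (Fin 2) (Fin 2) ℂ)
                  * (fun b : PBond (F.P K) 0 => gSer ℂ (ad ℂ (-A₁ b)) (α b)) ⟨p.src.shift p.ν, p.μ⟩
                  * star ((U' ⟨p.src, p.μ⟩ * U' ⟨p.src.shift p.μ, p.ν⟩ * (U' ⟨p.src.shift p.ν, p.μ⟩)⁻¹ : Matrix.specialUnitaryGroup (Fin 2) ℂ) : Matrix (Fin 2) (Fin 2) ℂ)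
              - ((GaugeField.plaqHol U' p : Matrix.specialUnitaryGroup (Fin 2) ℂ) : Matrix (Fin 2) (Fin 2) ℂ) * (fun b : PBond (F.P K) 0 => gSer ℂ (ad ℂ (-A₁ b)) (α b)) ⟨p.src, p.ν⟩
                  * star ((GaugeField.plaqHol U' p : Matrix.specialUnitaryGroup (Fin 2) ℂ) : Matrix (Fin 2) (Fin 2) ℂ))
            * ((GaugeField.plaqHol U' p : Matrix.specialUnitaryGroup (Fin 2) ℂ) : Matrix (Fin 2) (Fin 2) ℂ))).trace).re) 0 := by
  -- `Γ(0) = U′`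
  have hΓ0 : Γ 0 = U' := by
    funext b
    apply Subtype.ext
    rw [hΓ 0 b, hU' b, hc0]
  refine hasDerivAt_wilsonAction4_of_hasDerivAt_mulStar U' Γ hΓ0 (fun b : PBond (F.P K) 0 => gSer ℂ (ad ℂ (-A₁ b)) (α b)) fun b => ?_
  -- the bond velocity `d∕dt|₀ Γ(t)(b)·U′(b)^* = g(ad(−A₁ b))(α b)` (§1 along the exponent curve `t ↦ c t b`)
  have hP : ((U₀ b : Matrix.specialUnitaryGroup (Fin 2) ℂ) : Matrix (Fin 2) (Fin 2) ℂ) * star ((U₀ b : Matrix.specialUnitaryGroup (Fin 2) ℂ) : Matrix (Fin 2) (Fin 2) ℂ) = 1 :=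
    (Matrix.mem_unitaryGroup_iff).1 (Matrix.mem_specialUnitaryGroup_iff.1 (U₀ b).2).1
  have hX : star (c 0 b) = -c 0 b := by rw [hc0]; exact hA₁ b
  have h1 := hasDerivAt_exp_comp_mul_mul_star (c := fun t : ℝ => c t b) (hcd b) hX hP
  have hfun : (fun t : ℝ => ((Γ t b : Matrix.specialUnitaryGroup (Fin 2) ℂ) : Matrix (Fin 2) (Fin 2) ℂ) * star ((U' b : Matrix.specialUnitaryGroup (Fin 2) ℂ) : Matrix (Fin 2) (Fin 2) ℂ))
      = fun t : ℝ => exp (c t b) * ((U₀ b : Matrix.specialUnitaryGroup (Fin 2) ℂ) : Matrix (Fin 2) (Fin 2) ℂ)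
          * star (exp (c 0 b) * ((U₀ b : Matrix.specialUnitaryGroup (Fin 2) ℂ) : Matrix (Fin 2) (Fin 2) ℂ)) := by
    funext t; rw [hΓ t b, hU' b, hc0]
  rw [hfun]
  simp only [hc0] at h1 ⊢
  exact h1


end Member

end Summit.QuantumFields.YangMills.Theorems.Prop7ChartVelocityDexp

end
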